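import Literature.NumberTheory.LFunctions.SemimultiplicativeMoebiusAlmostPeriodic
import Literature.NumberTheory.LFunctions.SemimultiplicativeMoebiusStructured
import Literature.NumberTheory.LFunctions.SemimultiplicativeMoebiusKataiCriterion
import Mathlib.Analysis.SpecialFunctions.Sqrt
import HarnessLib

/-!
# Konieczny 2020, Theorem 1: Möbius orthogonality of `q`-semimultiplicative sequences — proved

Topic `Literature/NumberTheory/LFunctions`. Everything in this file is PROVED; it discharges the
named fact `Literature.NumberTheory.LFunctions.konieczny_semimultiplicative_moebius`
(J. Konieczny, *Möbius orthogonality for q-semimultiplicative sequences*, Monatsh. Math. 192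
(2020) 853–882, Theorem 1; arXiv:1808.06196) following the printed proof (§2 "Proof structure",
§8 "Proof of the main theorem"):

**Theorem 2 (dichotomy).**  Let `f` be unimodular and `q`-semimultiplicative.  Either, for all
distinct primes `p, p' > q`, the correlations `𝔼_{n<N} f(pn) conj f(p'n)` tend to `0` — then
`𝔼_{n<N} f(n) μ(n) → 0` by the Kátai–Bourgain–Sarnak–Ziegler criterion (Theorem 2.1,
`Konieczny.katai_criterion_moebius`); or some pair fails — then (§8) `g = f(p·) conj f(p'·)` is
`q`-quasimultiplicative with non-vanishing Cesàro means, so its window defects are summable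
(Proposition 5.4 (1)⇒(2), `Konieczny.tendsto_avg_of_not_summable_delta`), so `f` is
`C·(local deviation)`-close to a character `n ↦ ω^n` with `ω` a root of unity on all far
windows (Proposition 7.1 / Corollary 7.4 / Remark 7.3, `Konieczny.structured`), so the twisted
sequence `h = f · ω^{-n}` (again `q`-semimultiplicative) has summable local defects, hence
uniformly small defects on all far windows (Proposition 6.3, `Konieczny.local_control`), hence
is almost periodic (Proposition 5.4 (2)⇒(3), `Konieczny.isAlmostPeriodic_of_small_defects`), so
`f = h · ω^n` is almost periodic (Lemma 2.5) and orthogonal to `μ` (Lemma 2.3,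
`Konieczny.IsAlmostPeriodic.tendsto_moebius`, resting on the prime number theorem in
arithmetic progressions via `SiegelWalfiszMoebius_holds`).

* `Konieczny.isAlmostPeriodic_of_structured` — the structured branch of Theorem 2;
* `konieczny_semimultiplicative_moebius_holds` — Theorem 1.
-/

noncomputable section

open Finset Filter
open scoped ComplexConjugate Topology ArithmeticFunction.Moebius

namespace Literature.NumberTheory.LFunctions

namespace Konieczny

/-! ## The correlation sequence `g = f(p·) conj f(p'·)` -/

/-- `g(n) = f(pn) conj f(p'n)` is `q`-quasimultiplicative with gap `≤ B + r` when `p, p' ≤ q^B`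
(Lemma 3.4 (2) of Konieczny 2020 in the case needed). [cite: Konieczny2020, Lemma 3.4] -/
theorem isQuasimult_corr {q r : ℕ} (hq : 2 ≤ q) {f : ℕ → ℂ} (hf : IsSemimultiplicative q r f)
    {p p' B : ℕ} (hp : p ≤ q ^ B) (hp' : p' ≤ q ^ B) :
    IsQuasimult q (B + r) (fun n => f (p * n) * conj (f (p' * n))) := by
  have hQM := isQuasimult hq hf
  intro l x y hy hx
  have key : ∀ c, c ≤ q ^ B → f (c * (x + y)) = f (c * x) * f (c * y) := by
    intro c hc
    rw [mul_add]
    refine hQM (l + B) (c * x) (c * y) ?_ ?_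
    · calc c * y ≤ q ^ B * y := Nat.mul_le_mul_right y hc
        _ < q ^ B * q ^ l := Nat.mul_lt_mul_of_pos_left hy (pow_pos (by omega) B)
        _ = q ^ (l + B) := by rw [← pow_add, add_comm]
    · rw [show l + B + r = l + (B + r) by ring]
      exact dvd_mul_of_dvd_right hx c
  simp only
  rw [key p hp, key p' hp', map_mul]
  ring

/-- The correlation of the swapped pair is the conjugate: Cesàro convergence to `0` transfers.
[folklore] -/
theorem tendsto_corr_swap {f : ℕ → ℂ} {p p' : ℕ}
    (h : Tendsto (fun N : ℕ => (N : ℂ)⁻¹ * ∑ n ∈ range N, f (p * n) * conj (f (p' * n)))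
      atTop (𝓝 0)) :
    Tendsto (fun N : ℕ => (N : ℂ)⁻¹ * ∑ n ∈ range N, f (p' * n) * conj (f (p * n)))
      atTop (𝓝 0) := by
  have hc := (Complex.continuous_conj.tendsto 0).comp h
  rw [map_zero] at hc
  refine hc.congr fun N => ?_
  simp only [Function.comp_apply, map_mul, map_inv₀, map_natCast, map_sum, Complex.conj_conj]
  congr 1
  exact sum_congr rfl fun n _ => mul_comm _ _

/-- **From window defects of `g` to local deviations** (Lemma 4.1 / Lemma 6.1 bookkeeping): for
unimodular `f` with `f(0) = 1`,
`(∑_{m<q^ℓ} ‖f(p m q^K) - f(p' m q^K)‖)² ≤ q^ℓ (4 + 4q^ℓ) q^ℓ · δ_{K,ℓ}(g)`,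
`g = f(p·) conj f(p'·)`. [folklore] -/
theorem dev_sq_le {q : ℕ} (hq : 2 ≤ q) {f : ℕ → ℂ} (hf1 : ∀ n, ‖f n‖ = 1) (hf0 : f 0 = 1)
    (p p' ℓ K : ℕ) :
    (∑ m ∈ range (q ^ ℓ), ‖f (p * (m * q ^ K)) - f (p' * (m * q ^ K))‖) ^ 2 ≤
      (q : ℝ) ^ ℓ * ((4 + 4 * (q : ℝ) ^ ℓ) * (q : ℝ) ^ ℓ *
        (1 - ‖∑ c ∈ range (q ^ ℓ), f (p * (c * q ^ K)) * conj (f (p' * (c * q ^ K)))‖ / (q : ℝ) ^ ℓ)) := by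
  have hqpos : 0 < q := by omega
  have hqℓ : (0 : ℝ) < (q : ℝ) ^ ℓ := by positivity
  set G : ℕ → ℂ := fun c => f (p * (c * q ^ K)) * conj (f (p' * (c * q ^ K))) with hG
  have hG1 : ∀ c, ‖G c‖ = 1 := by
    intro c; rw [hG]; simp only [norm_mul, Complex.norm_conj, hf1, mul_one]
  have hdevG : ∀ m, ‖f (p * (m * q ^ K)) - f (p' * (m * q ^ K))‖ = ‖G m - 1‖ := by
    intro m; rw [hG]; exact (norm_mul_conj_sub_one (hf1 _)).symm
  simp_rw [hdevG]
  -- Cauchy–Schwarz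
  have hCS := sum_mul_sq_le_sq_mul_sq (range (q ^ ℓ)) (fun _ => (1 : ℝ)) (fun m => ‖G m - 1‖)
  simp only [one_mul, one_pow, sum_const, card_range, nsmul_eq_mul, mul_one] at hCS
  push_cast at hCS
  refine hCS.trans (mul_le_mul_of_nonneg_left ?_ hqℓ.le)
  -- optimal constant `ζ` and `Δ = ∑ ‖G - ζ‖²`
  obtain ⟨ζ, hζ1, hζ⟩ := exists_sum_norm_sub_sq_eq (range (q ^ ℓ)) (G := G) (fun m _ => hG1 m)
  rw [card_range] at hζ
  set Δ : ℝ := ∑ m ∈ range (q ^ ℓ), ‖G m - ζ‖ ^ 2 with hΔ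
  have hΔeq : Δ = 2 * (q : ℝ) ^ ℓ *
      (1 - ‖∑ c ∈ range (q ^ ℓ), G c‖ / (q : ℝ) ^ ℓ) := by
    rw [hζ]; push_cast; field_simp
  have hΔ0 : 0 ≤ Δ := sum_nonneg fun m _ => by positivity
  have hζnear : ‖ζ - 1‖ ^ 2 ≤ Δ := by
    have h0 : 0 ∈ range (q ^ ℓ) := mem_range.2 (pow_pos hqpos ℓ)
    have hG0 : G 0 = 1 := by rw [hG]; simp [hf0]
    have := single_le_sum (f := fun m => ‖G m - ζ‖ ^ 2) (fun m _ => by positivity) h0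
    rw [hG0, norm_sub_rev] at this
    exact this
  calc ∑ m ∈ range (q ^ ℓ), ‖G m - 1‖ ^ 2
      ≤ ∑ m ∈ range (q ^ ℓ), (2 * ‖G m - ζ‖ ^ 2 + 2 * ‖ζ - 1‖ ^ 2) := by
        refine sum_le_sum fun m _ => ?_
        have h1 : ‖G m - 1‖ ≤ ‖G m - ζ‖ + ‖ζ - 1‖ := norm_sub_le_norm_sub_add_norm_sub _ _ _
        have h4 : ‖G m - 1‖ ^ 2 ≤ (‖G m - ζ‖ + ‖ζ - 1‖) ^ 2 := pow_le_pow_left₀ (norm_nonneg _) h1 2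
        nlinarith [sq_nonneg (‖G m - ζ‖ - ‖ζ - 1‖)]
    _ = 2 * Δ + 2 * (q ^ ℓ : ℕ) * ‖ζ - 1‖ ^ 2 := by
        rw [sum_add_distrib, ← mul_sum, sum_const, card_range, nsmul_eq_mul, ← hΔ]; ring
    _ ≤ 2 * Δ + 2 * (q : ℝ) ^ ℓ * Δ := by push_cast; gcongr
    _ = (4 + 4 * (q : ℝ) ^ ℓ) * (q : ℝ) ^ ℓ *
        (1 - ‖∑ c ∈ range (q ^ ℓ), G c‖ / (q : ℝ) ^ ℓ) := by rw [hΔeq]; ring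

/-- `n ↦ c^n` is `q`-semimultiplicative with any gap (it is a character of `(ℕ, +)`). [folklore] -/
theorem isSemimultiplicative_pow (q r : ℕ) (c : ℂ) : IsSemimultiplicative q r (fun n => c ^ n) := by
  refine ⟨pow_zero c, fun l n m k _ _ _ _ => ?_⟩
  simp only [pow_add]; ring

/-! ## The structured branch of Theorem 2 -/

/-- **Konieczny 2020, Theorem 2, structured branch (§8).**  Let `f` be unimodular and
`q`-semimultiplicative with gap `≤ r` (`r ≥ 1`), and let `p' < p` be primes `> q` for which
`𝔼_{n<N} f(pn) conj f(p'n) ↛ 0`.  Then `f` is almost periodic. [cite: Konieczny2020, Theorem 2] -/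
theorem isAlmostPeriodic_of_structured {q r : ℕ} (hq : 2 ≤ q) (hr : 1 ≤ r) {f : ℕ → ℂ}
    (hf : IsSemimultiplicative q r f) (hf1 : ∀ n, ‖f n‖ = 1) {p p' : ℕ} (hp : p.Prime)
    (hp' : p'.Prime) (hp'p : p' < p) (hqp' : q < p')
    (hnot : ¬ Tendsto (fun N : ℕ => (N : ℂ)⁻¹ * ∑ n ∈ range N, f (p * n) * conj (f (p' * n)))
      atTop (𝓝 0)) :
    IsAlmostPeriodic f := by
  have hqpos : 0 < q := by omega
  have hq1 : 1 < q := by omega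
  have hf1' : ∀ n, ‖f n‖ ≤ 1 := fun n => (hf1 n).le
  have hcop : Nat.Coprime q p := by
    refine Nat.Coprime.symm ((Nat.Prime.coprime_iff_not_dvd hp).2 fun h => ?_)
    have := Nat.le_of_dvd hqpos h
    omega
  obtain ⟨ℓ, s₀, D, hD, C, hC0, H⟩ := structured hq hr hf hf1 hp'p hp'.pos hcop
  -- the correlation sequence and its summable defects
  set g : ℕ → ℂ := fun n => f (p * n) * conj (f (p' * n)) with hgdef
  have hpB : p ≤ q ^ p := (Nat.lt_pow_self hq1).le
  have hgQM : IsQuasimult q (p + r) g := isQuasimult_corr hq hf hpB (le_trans hp'p.le hpB)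
  have hg1 : ∀ n, ‖g n‖ ≤ 1 := by
    intro n; simp only [hgdef, norm_mul, Complex.norm_conj, hf1, mul_one]; exact le_rfl
  set δ : ℕ → ℝ := fun K => 1 - ‖∑ c ∈ range (q ^ ℓ), g (c * q ^ K)‖ / (q : ℝ) ^ ℓ with hδdef
  have hδsum : Summable δ := by
    by_contra hns
    exact hnot (tendsto_avg_of_not_summable_delta hq hgQM hg1 ℓ hns)
  have hδ0 : ∀ K, 0 ≤ δ K := fun K => (window_defect_mem hq hg1 K ℓ).1
  -- the local deviations tend to zero
  set cst : ℝ := (q : ℝ) ^ ℓ * ((4 + 4 * (q : ℝ) ^ ℓ) * (q : ℝ) ^ ℓ) with hcst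
  have hcst0 : 0 ≤ cst := by positivity
  set dev : ℕ → ℝ := fun K => ∑ m ∈ range (q ^ ℓ), ‖f (p * (m * q ^ K)) - f (p' * (m * q ^ K))‖
    with hdevdef
  have hdev0 : ∀ K, 0 ≤ dev K := fun K => sum_nonneg fun m _ => norm_nonneg _
  have hdevsq : ∀ K, dev K ^ 2 ≤ cst * δ K := by
    intro K
    have h := dev_sq_le hq hf1 hf.1 p p' ℓ K
    simp only [hcst, hδdef, hgdef, mul_assoc] at h ⊢
    linarith
  have hdev_le : ∀ K, dev K ≤ Real.sqrt (cst * δ K) := by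
    intro K
    rw [← Real.sqrt_sq (hdev0 K)]
    exact Real.sqrt_le_sqrt (hdevsq K)
  have hdevT : Tendsto dev atTop (𝓝 0) := by
    have h1 : Tendsto (fun K => Real.sqrt (cst * δ K)) atTop (𝓝 0) := by
      have := (hδsum.tendsto_atTop_zero.const_mul cst).sqrt
      rw [mul_zero, Real.sqrt_zero] at this
      exact this
    exact tendsto_of_tendsto_of_tendsto_of_le_of_le tendsto_const_nhds h1 hdev0 hdev_le
  obtain ⟨ω, k₁, hωD, hk₁, Hω⟩ := H hdevT
  -- the twisted sequence `h = f · conj ω ^ n`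
  have hω1 : ‖ω‖ = 1 := by
    have h : ‖ω‖ ^ D = 1 := by rw [← norm_pow, hωD, norm_one]
    exact (pow_eq_one_iff_of_nonneg (norm_nonneg _) hD.ne').1 h
  have hωω : ω * conj ω = 1 := mul_conj_eq_one_of_norm hω1
  set h : ℕ → ℂ := fun n => f n * conj ω ^ n with hhdef
  have hh1 : ∀ n, ‖h n‖ = 1 := by
    intro n; simp only [hhdef, norm_mul, norm_pow, Complex.norm_conj, hf1, hω1, one_pow, mul_one]
  have hhSM : IsSemimultiplicative q r h := mul hf (isSemimultiplicative_pow q r (conj ω))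
  -- window defects of `h` on far windows are `≤ (C dev)²`
  have hwin : ∀ k, k₁ ≤ k → ∀ l', l' ≤ 2 * r →
      1 - ‖∑ c ∈ range (q ^ l'), h (c * q ^ k)‖ / (q : ℝ) ^ l' ≤ (C * dev (k - s₀)) ^ 2 := by
    intro k hk l' hl'
    have hql' : (0 : ℝ) < (q : ℝ) ^ l' := by positivity
    have h2 := two_mul_card_sub_le_sum_norm_sub_sq (range (q ^ l')) (G := fun c => h (c * q ^ k))
      (fun c _ => hh1 _) (Z := 1) (by simp)
    rw [card_range] at h2
    have hterm : ∀ c ∈ range (q ^ l'), ‖h (c * q ^ k) - 1‖ ^ 2 ≤ (C * dev (k - s₀)) ^ 2 := by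
      intro c hc
      rw [mem_range] at hc
      have hc' : c < q ^ (2 * r) := lt_of_lt_of_le hc (Nat.pow_le_pow_right hqpos hl')
      have hb := Hω k hk c hc'
      have heq : ‖h (c * q ^ k) - 1‖ = ‖f (c * q ^ k) - ω ^ (c * q ^ k)‖ := by
        simp only [hhdef, ← map_pow]
        exact norm_mul_conj_sub_one (by rw [norm_pow, hω1, one_pow])
      rw [heq]
      exact pow_le_pow_left₀ (norm_nonneg _) hb 2
    have hsum : ∑ c ∈ range (q ^ l'), ‖h (c * q ^ k) - 1‖ ^ 2 ≤ (q ^ l' : ℕ) * (C * dev (k - s₀)) ^ 2 := by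
      calc _ ≤ ∑ c ∈ range (q ^ l'), (C * dev (k - s₀)) ^ 2 := sum_le_sum hterm
        _ = _ := by rw [sum_const, card_range, nsmul_eq_mul]
    push_cast at h2 hsum
    have key : (q : ℝ) ^ l' * (1 - ‖∑ c ∈ range (q ^ l'), h (c * q ^ k)‖ / (q : ℝ) ^ l') ≤
        (q : ℝ) ^ l' * (C * dev (k - s₀)) ^ 2 := by
      have : (q : ℝ) ^ l' * (1 - ‖∑ c ∈ range (q ^ l'), h (c * q ^ k)‖ / (q : ℝ) ^ l') =
          (q : ℝ) ^ l' - ‖∑ c ∈ range (q ^ l'), h (c * q ^ k)‖ := by field_simp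
      rw [this]
      nlinarith [h2, hsum, sq_nonneg (C * dev (k - s₀))]
    exact le_of_mul_le_mul_left key hql'
  -- summability of the local defects of `h`
  set a : ℕ → ℝ := fun k => ∑ l ∈ Icc 1 (2 * r),
    (1 - ‖∑ c ∈ range (q ^ l), h (c * q ^ k)‖ / (q : ℝ) ^ l) with hadef
  have ha0 : ∀ k, 0 ≤ a k := fun k => sum_nonneg fun l _ => (window_defect_mem hq (fun n => (hh1 n).le) k l).1
  have hale : ∀ k, k₁ ≤ k → a k ≤ 2 * r * C ^ 2 * cst * δ (k - s₀) := by
    intro k hk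
    calc a k ≤ ∑ l ∈ Icc 1 (2 * r), (C * dev (k - s₀)) ^ 2 :=
          sum_le_sum fun l hl => hwin k hk l (mem_Icc.1 hl).2
      _ = 2 * r * (C ^ 2 * dev (k - s₀) ^ 2) := by
          rw [sum_const, Nat.card_Icc, nsmul_eq_mul]; push_cast; ring
      _ ≤ 2 * r * (C ^ 2 * (cst * δ (k - s₀))) := by gcongr; exact hdevsq _
      _ = _ := by ring
  have hbsum : Summable (fun k : ℕ => 2 * r * C ^ 2 * cst * δ (k - s₀)) := by
    rw [← summable_nat_add_iff s₀]
    simp only [Nat.add_sub_cancel]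
    exact hδsum.mul_left _
  have hasum : Summable a := by
    rw [← summable_nat_add_iff k₁]
    refine Summable.of_nonneg_of_le (fun k => ha0 _) (fun k => hale (k + k₁) (Nat.le_add_left _ _)) ?_
    exact (summable_nat_add_iff k₁).2 hbsum
  have htail : Tendsto (fun K : ℕ => ∑' k, a (k + K)) atTop (𝓝 0) := tendsto_sum_nat_add a
  -- uniform smallness of all far window defects (Proposition 6.3)
  have hsmall : ∀ κ : ℝ, 0 < κ → ∃ K₁ : ℕ, ∀ K L : ℕ, K₁ ≤ K →
      1 - ‖∑ c ∈ range (q ^ L), h (c * q ^ K)‖ / (q : ℝ) ^ L ≤ κ := by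
    intro κ hκ
    have hev := htail.eventually (gt_mem_nhds (show (0 : ℝ) < κ / 12 by positivity))
    obtain ⟨K₁, hK₁⟩ := eventually_atTop.1 hev
    refine ⟨K₁, fun K L hK => ?_⟩
    have hlc := local_control hq hr hhSM hh1 K L
    have hIco : ∑ k ∈ Ico K (K + L), a k ≤ ∑' k, a (k + K) := by
      rw [sum_Ico_eq_sum_range, Nat.add_sub_cancel_left]
      have hs : Summable (fun k => a (k + K)) := (summable_nat_add_iff K).2 hasum
      have := hs.sum_le_tsum (range L) (fun k _ => ha0 _)
      refine le_trans (le_of_eq (sum_congr rfl fun k _ => by rw [add_comm])) this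
    have := hK₁ K hK
    linarith
  -- Proposition 5.4 (2) ⇒ (3) for `h`, then back to `f`
  have hAPh : IsAlmostPeriodic h :=
    isAlmostPeriodic_of_small_defects hq (isQuasimult hq hhSM) hh1 hsmall
  have hfh : f = fun n => h n * ω ^ n := by
    funext n
    simp only [hhdef]
    rw [mul_assoc, ← mul_pow, mul_comm (conj ω) ω, hωω, one_pow, mul_one]
  rw [hfh]
  exact hAPh.mul_periodic hD (fun n => by simp only [pow_add, hωD, mul_one])
    (fun n => by rw [norm_pow, hω1, one_pow])

end Konieczny

/-! ## Theorem 1 -/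

open Konieczny in
/-- **Konieczny 2020, Theorem 1, proved**: every unimodular `q`-semimultiplicative sequence
(`q ≥ 2`) is orthogonal to the Möbius function, `𝔼_{n<N} f(n) μ(n) → 0`.  Discharges the named
fact `Literature.NumberTheory.LFunctions.konieczny_semimultiplicative_moebius`.
[cite: Konieczny2020, Theorem 1] -/
theorem konieczny_semimultiplicative_moebius_holds : konieczny_semimultiplicative_moebius := by
  intro q hq r f hf1 hf
  set r' := max r 1 with hr'def
  have hr' : 1 ≤ r' := le_max_right _ _
  have hf' : IsSemimultiplicative q r' f := gap_mono hq (le_max_left _ _) hf hf1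
  by_cases hall : ∀ p p' : ℕ, p.Prime → p'.Prime → p ≠ p' → q < p → q < p' →
      Tendsto (fun N : ℕ => (N : ℂ)⁻¹ * ∑ n ∈ range N, f (p * n) * conj (f (p' * n))) atTop (𝓝 0)
  · exact katai_criterion_moebius (fun n => (hf1 n).le) q hall
  · push Not at hall
    obtain ⟨p, p', hp, hp', hne, hqp, hqp', hnot⟩ := hall
    have hAP : IsAlmostPeriodic f := by
      rcases lt_or_gt_of_ne hne with h | h
      · exact isAlmostPeriodic_of_structured hq hr' hf' hf1 hp' hp h hqp
          (fun ht => hnot (tendsto_corr_swap ht))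
      · exact isAlmostPeriodic_of_structured hq hr' hf' hf1 hp hp' h hqp' hnot
    exact hAP.tendsto_moebius (fun n => (hf1 n).le)

end Literature.NumberTheory.LFunctions
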